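import Summits.HubbardSuperconductivity.HubbardSuperconductivity.Theorems.BalabanIRBirEveryGroundStateStubLiebAnchor
import Literature.MathematicalPhysics.QuantumLattice.PairCorrelations

/-!
# Route `LiebTwin`, crux `TwinOnsiteCondensation` (item `stmt-HubbardSuperconductivity-15258`), line `birth`:
# the attractive ground state is its own twin

Helper (`--supports`, registered sub-goal `attractiveTwin_eq_smul`) for the crux
`Summit.HubbardSuperconductivity.HubbardSuperconductivity.Theses.LiebTwin.TwinOnsiteCondensation`,
line `birth` (`Cruxes/TwinOnsiteCondensation/Lines/birth.lean`), stubs `stub_attractiveOnsiteLRO` /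
`stub_twinDominatesAttractive`: the Lieb reduction both stubs lean on.

**Statements.**
1. (`exists_liebVec_cfcAbs_liebW_eq_smul`, `attractiveTwin_eq_smul`) For `U < 0`, `t ≠ 0`, a connected
   graph `G` (in particular the fermionic torus `fermionTorusGraph 2 L`, `L ≠ 0`, `t = 1`) and EVERY
   ground state `ψ` of `hamiltonian G t U` in the joint sector `(N, S^z) = (2n, 0)`
   (`IsGroundStateInSector`), the TWIN of the route, `ψ̃ := liebVec n |liebW n ψ|` with
   `|W| = (WᴴW)^{1/2} = CFC.abs W` the absolute value of Lieb's coefficient matrix, is `ψ` up to a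
   phase: `ψ̃ = u • ψ`, `‖u‖ = 1`. Hence every expectation value agrees, `⟨ψ̃, A ψ̃⟩ = ⟨ψ, A ψ⟩`
   (`expect_attractiveTwin`; in particular the pair-field orders `F_g(ψ̃) = F_g(ψ)` of the crux,
   `re_expect_pairField_sWave_attractiveTwin`), `‖ψ̃‖ = ‖ψ‖` and `ψ̃` is again a sector ground state
   (`isGroundStateInSector_attractiveTwin`). So at an attractive coupling the crux K2 and the sibling
   statement `AttractiveOnsiteLRO` (stub A of the line) are literally the same assertion.
2. (`liebOp_liebW_of_isGroundStateInSector`, `isGroundStateInSector_liebVec_of_liebOp_eq`,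
   `exists_posDef_groundMatrix_of_isGroundStateInSector`, `…_hubbardTorus`) The dictionary between
   sector ground states and Lieb's ground MATRICES in the crux's normalisation: `liebW n ψ` of a sector
   ground state solves Lieb's matrix equation (4), `K P + P K + U Σ_x L_x P L_x = E P`, at the sector
   energy `E = minEnergyOn H (szSector (2n) 0)` (any `U`); a nonzero solution `P` gives the sector ground
   state `liebVec n P` (any `U`); and for `U < 0` every NORMALISED sector ground state is
   `ψ = u • liebVec n P` with `‖u‖ = 1`, `P` positive definite of unit Hilbert–Schmidt norm `tr P² = 1`.
   Consequently `c·L⁴ ≤ F(ψ)` for every normalised attractive sector ground state is the same as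
   `c·L⁴·tr P² ≤ F(liebVec n P)` for every positive semidefinite solution `P` of (4) at the sector
   energy, for any phase-invariant quadratic functional `F` — the coordinates in which every known
   positivity tool (Lieb 1989, Tian 1992) operates, and in which stub A remains OPEN (`T = 0` `s`-wave
   ODLRO of the attractive 2D Hubbard ground state).

**Proof of 1.** `ψ ∈ szSector (2n) 0` is Lieb's `(n, n)` sector (`mem_szSector_two_mul_zero_iff`); the
sector energy bounds the quadratic form of `H` on it (`szSector_groundState`), so the attractive model is
a Lieb system (`LiebThm1.isLiebSystem_hubbard`) and `W = liebW n ψ ≠ 0` solves (4)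
(`LiebThm1.liebW_hamiltonian_mulVec`). Spin-reflection positivity (`IsLiebSystem.exists_posDef_eq_smul`)
gives `W = c • P` with `P` positive definite, `c ≠ 0`. In the matrix order `|c • P| = ‖c‖ • P`
(`cfcAbs_smul_of_posSemidef`: `(c • P)ᴴ (c • P) = (‖c‖ • P)²` and `CFC.sqrt_mul_self`), hence
`liebVec n |W| = (‖c‖/c) • liebVec n W = (‖c‖/c) • ψ` (`liebVec_smul`, `LiebThm1.liebVec_liebW`). For 2.,
`P := ‖c‖ • P₀`, `u := c/‖c‖` and `tr P² = tr WᴴW = ‖ψ‖² = 1` (`LiebThm1.hsInner_liebW`); the converse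
direction uses that `H (liebVec P)` and `E • liebVec P` lie in the sector with the same coefficient
matrix (`liebW` is injective on the sector).
Lieb, PRL 62 (1989) 1201, Theorem 1 and its proof ("`W = |W|` or `W = -|W|` for every ground state when
`U_x < 0`"), eq. (4); the phase bookkeeping is folklore. No definition and no named fact is introduced.

Design note. The general-graph twin theorem takes `[DecidableEq Λ]` as a free instance argument:
Mathlib's functional calculus on `Matrix (Config Λ n) (Config Λ n) ℂ` is assembled from
`DecidableEq (Config Λ n)`, and on the torus `FermionTorus 2 L = Lex (Fin 2 → Fin L)` instance search
finds the computable instance rather than the classical one inside `LinearOrder (FermionTorus 2 L)`; with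
the free argument the torus specialisations are syntactically the terms of the crux (checked by `rfl`
against the skeleton context).
-/

-- the mandated namespace `Summit.<Summit>.<Problem>.Theorems` repeats `HubbardSuperconductivity`
-- (single-problem summit, D-0017), which the `dupNamespace` linter flags on every declaration
set_option linter.dupNamespace false

noncomputable section

namespace Summit.HubbardSuperconductivity.HubbardSuperconductivity.Theorems

open Matrix
open Literature.MathematicalPhysics.QuantumLattice
open scoped ComplexOrder MatrixOrder Matrix.Norms.L2Operator

/-! ### Bookkeeping: linearity of `liebVec`, scaling of expectation values -/

section Bookkeeping

variable {Λ : Type*} [LinearOrder Λ] [Fintype Λ]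

/-- `liebVec` is homogeneous: `liebVec n (c • W) = c • liebVec n W` (the coefficient-matrix transfer
`W ↦ Σ W_{αβ} ψ^α_↑ ⊗ ψ^β_↓` is linear). Lieb, PRL 62 (1989) 1201, proof of Theorem 1 ("by linearity").
[folklore] -/
theorem liebVec_smul (n : ℕ) (c : ℂ) (W : Matrix (Config Λ n) (Config Λ n) ℂ) :
    liebVec n (c • W) = c • liebVec n W := by
  funext s
  simp only [liebVec, Pi.smul_apply, Matrix.smul_apply, smul_eq_mul]
  split_ifs
  · ring
  · rw [mul_zero]

/-- `liebVec` is additive. Lieb, PRL 62 (1989) 1201, proof of Theorem 1 ("by linearity"). [folklore] -/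
theorem liebVec_add (n : ℕ) (W Z : Matrix (Config Λ n) (Config Λ n) ℂ) :
    liebVec n (W + Z) = liebVec n W + liebVec n Z := by
  funext s
  simp only [liebVec, Pi.add_apply, Matrix.add_apply]
  split_ifs
  · ring
  · rw [add_zero]

variable {ι : Type*} [Fintype ι]

/-- Scaling of expectation values: `⟨c ψ, A (c ψ)⟩ = c̄ c ⟨ψ, A ψ⟩`. [folklore] -/
theorem expect_smul (A : Matrix (Finset ι) (Finset ι) ℂ) (c : ℂ) (ψ : Fock ι) :
    expect A (c • ψ) = star c * c * expect A ψ := by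
  simp only [expect, mulVec_smul, star_smul, smul_dotProduct, dotProduct_smul, smul_eq_mul]
  ring

/-- A phase does not change expectation values: `⟨u ψ, A (u ψ)⟩ = ⟨ψ, A ψ⟩` for `‖u‖ = 1`. [folklore] -/
theorem expect_smul_of_norm_eq_one (A : Matrix (Finset ι) (Finset ι) ℂ) {u : ℂ} (hu : ‖u‖ = 1)
    (ψ : Fock ι) : expect A (u • ψ) = expect A ψ := by
  rw [expect_smul, Complex.star_def, Complex.conj_mul', hu, Complex.ofReal_one, one_pow, one_mul]

/-- A phase does not change the norm: `⟨u ψ, u ψ⟩ = ⟨ψ, ψ⟩` for `‖u‖ = 1`. [folklore] -/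
theorem star_smul_dotProduct_smul_of_norm_eq_one {u : ℂ} (hu : ‖u‖ = 1) (ψ : Fock ι) :
    star (u • ψ) ⬝ᵥ (u • ψ) = star ψ ⬝ᵥ ψ := by
  rw [star_smul, smul_dotProduct, dotProduct_smul, smul_smul, smul_eq_mul, Complex.star_def,
    Complex.conj_mul', hu, Complex.ofReal_one, one_pow, one_mul]

end Bookkeeping

/-! ### The absolute value of a scalar multiple of a positive semidefinite matrix -/

section AbsSmul

variable {m : Type*} [Fintype m] [DecidableEq m]

/-- **`|c P| = |c| P` for `P ⪰ 0`.** In the matrix order (`open scoped MatrixOrder`) the continuous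
functional calculus absolute value `CFC.abs (c • P) = CFC.sqrt ((c • P)ᴴ (c • P))` of a complex multiple
of a positive semidefinite matrix is `‖c‖ • P`: `(c • P)ᴴ (c • P) = |c|² P² = (‖c‖ • P)²` with
`‖c‖ • P ⪰ 0`, and the square root of the square of a nonnegative element is the element
(`CFC.sqrt_mul_self`). [folklore] -/
theorem cfcAbs_smul_of_posSemidef {P : Matrix m m ℂ} (hP : P.PosSemidef) (c : ℂ) :
    CFC.abs (c • P) = ((‖c‖ : ℝ) : ℂ) • P := by
  have hc : (0 : ℂ) ≤ ((‖c‖ : ℝ) : ℂ) := Complex.zero_le_real.2 (norm_nonneg c)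
  have hQ : (((‖c‖ : ℝ) : ℂ) • P).PosSemidef := hP.smul hc
  have hmul : star (c • P) * (c • P) = (((‖c‖ : ℝ) : ℂ) • P) * (((‖c‖ : ℝ) : ℂ) • P) := by
    rw [star_smul, star_eq_conjTranspose, hP.1.eq, smul_mul_smul_comm, smul_mul_smul_comm,
      Complex.star_def, Complex.conj_mul', sq]
  rw [CFC.abs, hmul, CFC.sqrt_mul_self _ hQ.nonneg]

end AbsSmul

/-! ### The attractive ground state is its own twin (any connected graph) -/

section General

variable {Λ : Type*} [LinearOrder Λ] [Fintype Λ] (G : SimpleGraph Λ) [DecidableRel G.Adj]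

/-- **Lieb: the attractive sector ground state is its own twin, up to a phase.** For `G` connected,
`t ≠ 0`, `U < 0` and every ground state `ψ` of `hamiltonian G t U` in the joint sector
`(2n, S^z = 0)`, the twin `liebVec n |liebW n ψ|` (`|W| = CFC.abs W = (WᴴW)^{1/2}`) equals `u • ψ` for a
unit complex number `u`: by spin-reflection positivity `liebW n ψ = c • P` with `P` positive definite
(`LiebThm1.isLiebSystem_hubbard`, `IsLiebSystem.exists_posDef_eq_smul`), so `|liebW n ψ| = ‖c‖ • P` and
`u = ‖c‖ / c`. The instance `[DecidableEq Λ]` is a free argument on purpose: the matrix functional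
calculus behind `CFC.abs` is assembled from `DecidableEq (Config Λ n)`, and at a concrete lattice (the
torus) instance search finds the computable instance, not the one hidden in `LinearOrder Λ`; taking it as
an argument keeps the specialisations below definitionally equal to the directly elaborated crux terms.
Lieb, PRL 62 (1989) 1201, Theorem 1 and its proof. [cite: LiebPRL1989, Theorem 1] -/
theorem exists_liebVec_cfcAbs_liebW_eq_smul [DecidableEq Λ] (hG : G.Connected) {t U : ℝ} (ht : t ≠ 0)
    (hU : U < 0) {n : ℕ} {ψ : Fock (Orb Λ)}
    (hψ : IsGroundStateInSector (hamiltonian G t U) (2 * n) 0 ψ) :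
    ∃ u : ℂ, ‖u‖ = 1 ∧ liebVec n (CFC.abs (liebW n ψ)) = u • ψ := by
  obtain ⟨hψK, hψ0, hψeig⟩ := hψ
  have hsec : IsInSector n n ψ := (mem_szSector_two_mul_zero_iff n ψ).1 hψK
  set H := hamiltonian G t U with hH
  set E := H.minEnergyOn (szSector (2 * n) 0) with hE
  -- a sector vector needs `n` up-electrons on distinct sites, so `n ≤ |Λ|`
  have hn : n ≤ Fintype.card Λ := by
    by_contra hlt
    rw [not_le] at hlt
    apply hψ0
    funext s
    by_cases hs : (upPart s).card = n ∧ (downPart s).card = n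
    · exfalso
      have := Finset.card_le_univ (upPart s)
      omega
    · exact hsec s hs
  -- the attractive model in the `(n, n)` sector is a Lieb system at the sector energy
  have hEv : ∀ φ : Fock (Orb Λ), IsInSector n n φ → E * (star φ ⬝ᵥ φ).re ≤ (expect H φ).re :=
    (szSector_groundState G t U hn).2
  have hLS := LiebThm1.isLiebSystem_hubbard G hG ht hU n hEv
  -- `W = liebW n ψ ≠ 0` solves Lieb's matrix equation (4)
  set W := liebW n ψ with hW
  have hWeig : liebOp (liebK G t n) (liebL n) U W = (E : ℂ) • W := by
    rw [hW, ← LiebThm1.liebW_hamiltonian_mulVec, hψeig, liebW_smul]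
  have hW0 : W ≠ 0 := fun h => hψ0 ((LiebThm1.liebW_eq_zero_iff hsec).1 h)
  -- spin-reflection positivity: `W = c • P`, `P` positive definite, `c ≠ 0`
  obtain ⟨P, hP, -, c, hWcP⟩ := hLS.exists_posDef_eq_smul hWeig hW0
  have hc0 : c ≠ 0 := by
    rintro rfl
    exact hW0 (by rw [hWcP, zero_smul])
  refine ⟨((‖c‖ : ℝ) : ℂ) / c, ?_, ?_⟩
  · rw [norm_div, Complex.norm_real, norm_norm, div_self (norm_ne_zero_iff.2 hc0)]
  · have hsplit : ((‖c‖ : ℝ) : ℂ) • P = (((‖c‖ : ℝ) : ℂ) / c) • (c • P) := by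
      rw [smul_smul, div_mul_cancel₀ _ hc0]
    rw [hWcP, cfcAbs_smul_of_posSemidef hP.posSemidef c, hsplit, liebVec_smul, ← hWcP, hW,
      LiebThm1.liebVec_liebW hsec]

/-- **Ground state ⟹ ground matrix.** The coefficient matrix `W = liebW n ψ` of a `(2n, S^z = 0)`-sector
ground state `ψ` of `H = hamiltonian G t U` solves Lieb's matrix equation (4) at the sector energy:
`K W + W K + U Σ_x L_x W L_x = E W`, `E = minEnergyOn H (szSector (2n) 0)` (transfer
`liebW (H ψ) = 𝓗 (liebW ψ)`; any coupling `U`). Lieb, PRL 62 (1989) 1201, eq. (4). [cite: LiebPRL1989, eq. (4)] -/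
theorem liebOp_liebW_of_isGroundStateInSector (t U : ℝ) {n : ℕ} {ψ : Fock (Orb Λ)}
    (hψ : IsGroundStateInSector (hamiltonian G t U) (2 * n) 0 ψ) :
    liebOp (liebK G t n) (liebL n) U (liebW n ψ) =
      (((hamiltonian G t U).minEnergyOn (szSector (Λ := Λ) (2 * n) 0) : ℝ) : ℂ) • liebW n ψ := by
  rw [← LiebThm1.liebW_hamiltonian_mulVec, hψ.2.2, liebW_smul]

/-- **Ground matrix ⟹ ground state.** For every `P ≠ 0` solving Lieb's matrix equation (4) at the
sector energy, `𝓗 P = E P` with `E = minEnergyOn H (szSector (2n) 0)`, the vector `liebVec n P` is a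
`(2n, S^z = 0)`-sector ground state of `H = hamiltonian G t U` (any coupling `U`): it lies in the sector,
is nonzero (`liebW (liebVec P) = P`), and `H (liebVec P)`, `E • liebVec P` lie in the sector with the same
coefficient matrix, hence agree (`liebW` is injective on the sector). Lieb, PRL 62 (1989) 1201, eq. (4).
[cite: LiebPRL1989, eq. (4)] -/
theorem isGroundStateInSector_liebVec_of_liebOp_eq (t U : ℝ) {n : ℕ}
    {P : Matrix (Config Λ n) (Config Λ n) ℂ} (hP0 : P ≠ 0)
    (hP : liebOp (liebK G t n) (liebL n) U P =
      (((hamiltonian G t U).minEnergyOn (szSector (Λ := Λ) (2 * n) 0) : ℝ) : ℂ) • P) :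
    IsGroundStateInSector (hamiltonian G t U) (2 * n) 0 (liebVec n P) := by
  set φ := liebVec n P with hφ
  have hsec : IsInSector n n φ := isInSector_liebVec n P
  have hWφ : liebW n φ = P := LiebThm1.liebW_liebVec n P
  refine ⟨(mem_szSector_two_mul_zero_iff n φ).2 hsec, ?_, ?_⟩
  · intro h0
    apply hP0
    rw [← hWφ, h0, liebW_zero]
  · have h1 : IsInSector n n (hamiltonian G t U *ᵥ φ) :=
      (LiebThm1.preservesSectors_hamiltonian G t U).isInSector_mulVec hsec
    have h2 : IsInSector n n
        ((((hamiltonian G t U).minEnergyOn (szSector (Λ := Λ) (2 * n) 0) : ℝ) : ℂ) • φ) := hsec.smul _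
    have h3 : liebW n (hamiltonian G t U *ᵥ φ) =
        liebW n ((((hamiltonian G t U).minEnergyOn (szSector (Λ := Λ) (2 * n) 0) : ℝ) : ℂ) • φ) := by
      rw [LiebThm1.liebW_hamiltonian_mulVec, liebW_smul, hWφ, hP]
    rw [← sub_eq_zero, ← LiebThm1.liebW_eq_zero_iff (h1.sub h2), liebW_sub, h3, sub_self]

/-- **Lieb's Theorem 1 in the crux's normalisation.** For `G` connected, `t ≠ 0`, `U < 0` and every
NORMALISED ground state `ψ` of `hamiltonian G t U` in the joint sector `(2n, S^z = 0)` there are a positive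
definite solution `P` of Lieb's matrix equation (4) at the sector energy with unit Hilbert–Schmidt norm,
`tr(PᴴP) = 1`, and a phase `u`, `‖u‖ = 1`, with `ψ = u • liebVec n P`: spin-reflection positivity gives
`liebW n ψ = c • P₀`, `P₀ ≻ 0` (`LiebThm1.isLiebSystem_hubbard`, `IsLiebSystem.exists_posDef_eq_smul`);
take `P = ‖c‖ • P₀`, `u = c/‖c‖`, and `tr P² = tr WᴴW = ‖ψ‖² = 1` (`LiebThm1.hsInner_liebW`).
Lieb, PRL 62 (1989) 1201, Theorem 1 and its proof. [cite: LiebPRL1989, Theorem 1] -/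
theorem exists_posDef_groundMatrix_of_isGroundStateInSector (hG : G.Connected) {t U : ℝ} (ht : t ≠ 0)
    (hU : U < 0) {n : ℕ} {ψ : Fock (Orb Λ)} (hψ1 : star ψ ⬝ᵥ ψ = 1)
    (hψ : IsGroundStateInSector (hamiltonian G t U) (2 * n) 0 ψ) :
    ∃ P : Matrix (Config Λ n) (Config Λ n) ℂ, P.PosDef ∧
      liebOp (liebK G t n) (liebL n) U P =
        (((hamiltonian G t U).minEnergyOn (szSector (Λ := Λ) (2 * n) 0) : ℝ) : ℂ) • P ∧
      hsInner P P = 1 ∧ ∃ u : ℂ, ‖u‖ = 1 ∧ ψ = u • liebVec n P := by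
  obtain ⟨hψK, hψ0, hψeig⟩ := hψ
  have hsec : IsInSector n n ψ := (mem_szSector_two_mul_zero_iff n ψ).1 hψK
  set H := hamiltonian G t U with hH
  set E := H.minEnergyOn (szSector (Λ := Λ) (2 * n) 0) with hE
  -- a sector vector needs `n` up-electrons on distinct sites, so `n ≤ |Λ|`
  have hn : n ≤ Fintype.card Λ := by
    by_contra hlt
    rw [not_le] at hlt
    apply hψ0
    funext s
    by_cases hs : (upPart s).card = n ∧ (downPart s).card = n
    · exfalso
      have := Finset.card_le_univ (upPart s)
      omega
    · exact hsec s hs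
  have hEv : ∀ φ : Fock (Orb Λ), IsInSector n n φ → E * (star φ ⬝ᵥ φ).re ≤ (expect H φ).re :=
    (szSector_groundState G t U hn).2
  have hLS := LiebThm1.isLiebSystem_hubbard G hG ht hU n hEv
  set W := liebW n ψ with hW
  have hWeig : liebOp (liebK G t n) (liebL n) U W = (E : ℂ) • W := by
    rw [hW, ← LiebThm1.liebW_hamiltonian_mulVec, hψeig, liebW_smul]
  have hW0 : W ≠ 0 := fun h => hψ0 ((LiebThm1.liebW_eq_zero_iff hsec).1 h)
  obtain ⟨P₀, hP₀, hP₀gs, c, hWcP⟩ := hLS.exists_posDef_eq_smul hWeig hW0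
  have hc0 : c ≠ 0 := by
    rintro rfl
    exact hW0 (by rw [hWcP, zero_smul])
  have hcpos : (0 : ℂ) < ((‖c‖ : ℝ) : ℂ) := Complex.zero_lt_real.2 (norm_pos_iff.2 hc0)
  have hcne : (((‖c‖ : ℝ) : ℂ)) ≠ 0 := hcpos.ne'
  refine ⟨((‖c‖ : ℝ) : ℂ) • P₀, hP₀.smul hcpos, ?_, ?_, c / ((‖c‖ : ℝ) : ℂ), ?_, ?_⟩
  · rw [liebOp_smul, hP₀gs, smul_comm]
  · -- `tr P² = |c|² tr P₀² = tr WᴴW = ‖ψ‖² = 1`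
    have h1 : hsInner W W = 1 := by rw [hW, LiebThm1.hsInner_liebW hsec, hψ1]
    rw [hsInner_smul_left, hsInner_smul_right, Complex.star_def, Complex.conj_ofReal, ← h1, hWcP,
      hsInner_smul_left, hsInner_smul_right, Complex.star_def, ← mul_assoc, ← mul_assoc,
      Complex.conj_mul', sq]
  · rw [norm_div, Complex.norm_real, norm_norm, div_self (norm_ne_zero_iff.2 hc0)]
  · rw [← liebVec_smul, smul_smul, div_mul_cancel₀ _ hcne, ← hWcP, hW,
      LiebThm1.liebVec_liebW hsec]

end General

/-! ### The attractive Hubbard torus -/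

section Torus

/-- **The attractive torus ground state is its own twin** (registered sub-goal
`attractiveTwin_eq_smul` of item `stmt-HubbardSuperconductivity-15258`). For `U' < 0`, `L ≠ 0` and
every ground state `ψ` of `hubbardTorus 2 L 1 U'` in the joint sector `(2n, S^z = 0)`, the twin of route
`LiebTwin` is `ψ` up to a phase: `liebVec n (CFC.abs (liebW n ψ)) = u • ψ` with `‖u‖ = 1` (the torus
graph is connected, `fermionTorusGraph_connected`; `t = 1 ≠ 0`). Lieb, PRL 62 (1989) 1201, Theorem 1.
[cite: LiebPRL1989, Theorem 1] -/
theorem attractiveTwin_eq_smul :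
    ∀ (U' : ℝ), U' < 0 → ∀ (L : ℕ) [NeZero L] (n : ℕ) (ψ : Fock (Orb (FermionTorus 2 L))),
      IsGroundStateInSector (hubbardTorus 2 L 1 U') (2 * n) 0 ψ →
        ∃ u : ℂ, ‖u‖ = 1 ∧ liebVec n (CFC.abs (liebW n ψ)) = u • ψ :=
  fun _ hU' L _ _ _ hψ =>
    exists_liebVec_cfcAbs_liebW_eq_smul (fermionTorusGraph 2 L) (fermionTorusGraph_connected 2 L)
      one_ne_zero hU' hψ

/-- **Expectation values of the attractive twin.** For `U' < 0` and every `(2n, 0)`-sector ground state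
`ψ` of `hubbardTorus 2 L 1 U'` (`L ≠ 0`), every operator `A` has the same expectation in the twin as in
`ψ`: `⟨ψ̃, A ψ̃⟩ = ⟨ψ, A ψ⟩`, `ψ̃ = liebVec n (CFC.abs (liebW n ψ))`; in particular the pair-field orders
`F_g(ψ̃) = Re⟨ψ̃, (pairField g L)ᴴ (pairField g L) ψ̃⟩ = F_g(ψ)` of crux `TwinOnsiteCondensation`.
Lieb, PRL 62 (1989) 1201, Theorem 1. [cite: LiebPRL1989, Theorem 1] -/
theorem expect_attractiveTwin {U' : ℝ} (hU' : U' < 0) (L : ℕ) [NeZero L] {n : ℕ}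
    {ψ : Fock (Orb (FermionTorus 2 L))}
    (hψ : IsGroundStateInSector (hubbardTorus 2 L 1 U') (2 * n) 0 ψ)
    (A : Matrix (Finset (Orb (FermionTorus 2 L))) (Finset (Orb (FermionTorus 2 L))) ℂ) :
    expect A (liebVec n (CFC.abs (liebW n ψ))) = expect A ψ := by
  obtain ⟨u, hu, htwin⟩ := attractiveTwin_eq_smul U' hU' L n ψ hψ
  rw [htwin, expect_smul_of_norm_eq_one A hu]

/-- **The on-site pair order of the attractive twin** (the quantity of crux `TwinOnsiteCondensation` at
an attractive coupling): `F_s(ψ̃) = F_s(ψ)` for every `(2n, 0)`-sector ground state `ψ` of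
`hubbardTorus 2 L 1 U'`, `U' < 0`, `F_s(χ) = Re⟨χ, (pairField sWave L)ᴴ (pairField sWave L) χ⟩`.
Lieb, PRL 62 (1989) 1201, Theorem 1. [cite: LiebPRL1989, Theorem 1] -/
theorem re_expect_pairField_sWave_attractiveTwin {U' : ℝ} (hU' : U' < 0) (L : ℕ) [NeZero L] {n : ℕ}
    {ψ : Fock (Orb (FermionTorus 2 L))}
    (hψ : IsGroundStateInSector (hubbardTorus 2 L 1 U') (2 * n) 0 ψ) :
    (expect ((pairField sWave L)ᴴ * pairField sWave L) (liebVec n (CFC.abs (liebW n ψ)))).re =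
      (expect ((pairField sWave L)ᴴ * pairField sWave L) ψ).re := by
  rw [expect_attractiveTwin hU' L hψ]

/-- **The attractive twin has the norm of `ψ`**: `⟨ψ̃, ψ̃⟩ = ⟨ψ, ψ⟩` for every `(2n, 0)`-sector ground
state `ψ` of `hubbardTorus 2 L 1 U'`, `U' < 0` (so the twin of a normalised ground state is normalised).
Lieb, PRL 62 (1989) 1201, Theorem 1. [cite: LiebPRL1989, Theorem 1] -/
theorem star_attractiveTwin_dotProduct_self {U' : ℝ} (hU' : U' < 0) (L : ℕ) [NeZero L] {n : ℕ}
    {ψ : Fock (Orb (FermionTorus 2 L))}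
    (hψ : IsGroundStateInSector (hubbardTorus 2 L 1 U') (2 * n) 0 ψ) :
    star (liebVec n (CFC.abs (liebW n ψ))) ⬝ᵥ liebVec n (CFC.abs (liebW n ψ)) = star ψ ⬝ᵥ ψ := by
  obtain ⟨u, hu, htwin⟩ := attractiveTwin_eq_smul U' hU' L n ψ hψ
  rw [htwin, star_smul_dotProduct_smul_of_norm_eq_one hu]

/-- **The attractive twin is again a sector ground state**: for `U' < 0` and every `(2n, 0)`-sector
ground state `ψ` of `hubbardTorus 2 L 1 U'` (`L ≠ 0`), `ψ̃ = liebVec n (CFC.abs (liebW n ψ))` is a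
`(2n, 0)`-sector ground state of the same Hamiltonian (a nonzero multiple of `ψ`).
Lieb, PRL 62 (1989) 1201, Theorem 1. [cite: LiebPRL1989, Theorem 1] -/
theorem isGroundStateInSector_attractiveTwin {U' : ℝ} (hU' : U' < 0) (L : ℕ) [NeZero L] {n : ℕ}
    {ψ : Fock (Orb (FermionTorus 2 L))}
    (hψ : IsGroundStateInSector (hubbardTorus 2 L 1 U') (2 * n) 0 ψ) :
    IsGroundStateInSector (hubbardTorus 2 L 1 U') (2 * n) 0 (liebVec n (CFC.abs (liebW n ψ))) := by
  obtain ⟨u, hu, htwin⟩ := attractiveTwin_eq_smul U' hU' L n ψ hψ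
  have hu0 : u ≠ 0 := fun h => by rw [h, norm_zero] at hu; exact zero_ne_one hu
  rw [htwin]
  exact ⟨Submodule.smul_mem _ u hψ.1, smul_ne_zero hu0 hψ.2.1,
    by rw [mulVec_smul, hψ.2.2, smul_comm]⟩

/-- **Every normalised attractive torus ground state is a phase times `liebVec` of a unit positive
definite ground matrix.** For `U' < 0`, `L ≠ 0` and every normalised `(2n, S^z = 0)`-sector ground state
`ψ` of `hubbardTorus 2 L 1 U'`: `ψ = u • liebVec n P` with `‖u‖ = 1`, `P` positive definite,
`tr(PᴴP) = 1`, and `P` solving Lieb's equation (4) on the torus at the sector energy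
(`fermionTorusGraph_connected`, `t = 1 ≠ 0`). Lieb, PRL 62 (1989) 1201, Theorem 1.
[cite: LiebPRL1989, Theorem 1] -/
theorem exists_posDef_groundMatrix_of_isGroundStateInSector_hubbardTorus {U' : ℝ} (hU' : U' < 0)
    (L : ℕ) [NeZero L] {n : ℕ} {ψ : Fock (Orb (FermionTorus 2 L))} (hψ1 : star ψ ⬝ᵥ ψ = 1)
    (hψ : IsGroundStateInSector (hubbardTorus 2 L 1 U') (2 * n) 0 ψ) :
    ∃ P : Matrix (Config (FermionTorus 2 L) n) (Config (FermionTorus 2 L) n) ℂ, P.PosDef ∧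
      liebOp (liebK (fermionTorusGraph 2 L) 1 n) (liebL n) U' P =
        (((hubbardTorus 2 L 1 U').minEnergyOn (szSector (Λ := FermionTorus 2 L) (2 * n) 0) : ℝ) : ℂ) • P ∧
      hsInner P P = 1 ∧ ∃ u : ℂ, ‖u‖ = 1 ∧ ψ = u • liebVec n P :=
  exists_posDef_groundMatrix_of_isGroundStateInSector (fermionTorusGraph 2 L)
    (fermionTorusGraph_connected 2 L) one_ne_zero hU' hψ1 hψ

/-- **Ground matrices of the torus give sector ground states** (any coupling `U`): a nonzero solution
`P` of Lieb's equation (4) on the torus at the sector energy of `hubbardTorus 2 L t U` yields the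
`(2n, S^z = 0)`-sector ground state `liebVec n P`. Lieb, PRL 62 (1989) 1201, eq. (4).
[cite: LiebPRL1989, eq. (4)] -/
theorem isGroundStateInSector_liebVec_hubbardTorus (L : ℕ) (t U : ℝ) {n : ℕ}
    {P : Matrix (Config (FermionTorus 2 L) n) (Config (FermionTorus 2 L) n) ℂ} (hP0 : P ≠ 0)
    (hP : liebOp (liebK (fermionTorusGraph 2 L) t n) (liebL n) U P =
      (((hubbardTorus 2 L t U).minEnergyOn (szSector (Λ := FermionTorus 2 L) (2 * n) 0) : ℝ) : ℂ) • P) :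
    IsGroundStateInSector (hubbardTorus 2 L t U) (2 * n) 0 (liebVec n P) :=
  isGroundStateInSector_liebVec_of_liebOp_eq (fermionTorusGraph 2 L) t U hP0 hP

end Torus

end Summit.HubbardSuperconductivity.HubbardSuperconductivity.Theorems

end
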